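import Literature.MathematicalPhysics.QuantumFieldTheory.Balaban1983to89.B9Proj349MajFromBlocks
import Literature.MathematicalPhysics.QuantumFieldTheory.Balaban1983to89.B9Ineq349SiteFacesAtLetters

/-!
# BalabanUVNodes ∕ N06 ([B9], `Dag.B9_main`) — THE (3.49) MAJORANT SCHEMA `Proj349Maj` OF THE CERTIFICATE (`h49` of editions 19–24) DERIVED AT def-Y's
# MEMBERS WITH ITS RATE EXPOSED: from row 18's Theorem-3.7 leaf `t37′` (the (3.42) sup majorants at the site pins, rate `(1−2α)δ₀` of the pins `p`),
# rows 15–16's one display `h348` ((3.48)⁻¹, rate `δ39`), a RATE-EXPLICIT (3.49) threshold fact, dag-n06-l's block count and block-majorant reading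

Track A of `YM-PLAN.md` (cell `pub-ymgap`, HUMAN RULING D-0062), node **N06** = [Balaban1985BackgroundPropagators] Thms 3.1–3.15; seat `pub-ymgap-dag-n06-d`
(s2, «knit N06 at the ₁₁ record»), gen 10.  A HELPER for the stage-11 certificate editions ≥ 25.

THE PRINT.  p. 399: *«For the operator P = I − R we obtain, using again Lemma 2.1, (3.49)»*; p. 421: *«It is easy to find estimates for the operator Δ′_π
using Theorem 3.1 and the inequality (3.49)»*.  In the certificate (edition 24, p598690) the (3.49)-majorant of the coordinate model `PcoK … (GpY …) U` of
`P(U)` is the DISPLAYED binder `h49 : … Proj349Maj (𝔬12 x).blkW (𝔬12 x).blk (PcoK …) (DvcoKH …) (DvscoKH …) 1 (H x) CP δP`, and its rate `δP` heads the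
displayed RATE CASCADE of rows 20–21 (`hrTP : rT ≤ δP`, `hδTr`, `hρST`, `hδKS`, `hσSK`): the T-letters of (3.131)∕(3.137), the working rate `ρ_S` and
Theorem 3.12's kernel rate `δ_K` all sit below it.  Hence a DERIVED `h49` is usable by the certificate only with a CLOSED rate (house style: thresholds
existential, rates closed in the pin prims) — dag-n06-l's family face `B9Proj349MajFromBlocks.proj349Maj_of_blockSchemas` (rate hidden under `∃`, read off
the `∃`-schemas `Thm31SiteSchemas ∕ Thm32BlkSchema`) is therefore re-assembled here PER MEMBER at the explicit rate.

WHAT.  §1 — the two row-25 inputs with their RATES EXPOSED, for ANY letters family `𝔏` with def-Y's standard `parS = parSymY`, `Gp = GpY … (parSymY …)`: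
★ `left_right342_of_t37_pairM_of` — from row 18's leaf `t37` on the `PairM` E-letter at the site pins: `∃ M₁ a₀ B₀`, and for every member above the
threshold `Left342At … B₀ ((1−2p.α)p.δ₀) ∧ Right342At … B₀ ((1−2p.α)p.δ₀)` (n06-i's `left342At_of_hasMajorants`, `right342At_of_left342At` with
`isSymmTr_GpY_parSymY`, constants merged as in `thm31SiteSchemas_of_left` — the same proof as n06-i's `thm31SiteSchemas_of_t37_pairM_of` WITHOUT the
final `∃ δ₀`); ★ `blk348_of_display348_rate` — from rows 15–16's display `h348`: `Blk348At … (cR39 (basis39 _)·|κ39|·B₁·e^{2δ₁}) δ₁` at EVERY member of the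
display's regime (n06-i's `blk348At_of_hasMajorant`).  §2 ★★ `proj349Maj_of_t37_display348_rate` — given, in addition, a (3.49) THRESHOLD FACT AT AN
EXPLICIT RATE `θ` (the inner statement of n06-i's `B9Ineq349SiteFromBlocks.exists_threshold_349` at the rate pair `((1−2p.α)p.δ₀, δ₁)` with its `θ` a
parameter — supplied by the rate-exposed twin of that theorem), the direction-blind faithful block map (`hbI0 hlev hβ1`) and dag-n06-l's near-block count
`exists_card_nearBlocks_le` + block-majorant reading `proj349Maj_of_allBlocks`: `∃ M a CP, 0 < M ∧ 0 < a ∧ 0 ≤ CP ∧ ∀ x, M ≤ M_x → ∀ α₀ > 0, M_x α₀ ≤ a →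
∀ U, Reg335 → Proj349Maj (blkSK (sIK (bI x))) (blkBK (bI x)) (PcoK … (𝔏 x).parS (𝔏 x).Gp U) (DvcoKH … U) (DvscoKH … U) 1 (H x) CP θ` — the certificate's
`h49` up to the pins `hblkW12 ∕ hblk12`, at the rate `θ` the caller names (edition 25: `θ := min ((1−2p.α)p.δ₀) δ39 ∕ 8`).
HONEST FRAMING.  Kernel bookkeeping over landed readings (n06-i rows 25, n06-l F7); COUNT-NEUTRAL; nothing of [B9] asserted — the inputs `t37 ∕ h348` and the
threshold fact are hypotheses; N06 NOT discharged.  One finite 𝕋⁴ programme at fixed `ε` — NOT continuum, NOT OS, NOT the mass gap ∕ Clay.  0 `def`, 0 `sorry`.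
-/

noncomputable section

namespace Summit.QuantumFields.YangMills.BalabanUVNodes.N06Proj349AtPinsPhys

open Literature.MathematicalPhysics.QuantumFieldTheory.Balaban1983to89
open Literature.MathematicalPhysics.QuantumFieldTheory.Balaban1983to89.Node00
open Literature.MathematicalPhysics.QuantumFieldTheory.Balaban1983to89.B6KLevelCensusIndexV1 (KIdx)
open Literature.MathematicalPhysics.QuantumFieldTheory.Balaban1983to89.B6GlobalChartV1 (blkV1)
open Literature.MathematicalPhysics.QuantumFieldTheory.Balaban1983to89.B6Ineq2142KLevelV1 (lvl β)
open Literature.MathematicalPhysics.QuantumFieldTheory.Balaban1983to89.B9Thm34Ext (toB6)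
open Literature.MathematicalPhysics.QuantumFieldTheory.Balaban1983to89.B9Thm37Whole (Ops Conv342)
open Literature.MathematicalPhysics.QuantumFieldTheory.Balaban1983to89.B9Cor38Whole (WalkReading)
open Literature.MathematicalPhysics.QuantumFieldTheory.Balaban1983to89.B9Thm39WholeBlk (Conv348Blk)
open Literature.MathematicalPhysics.QuantumFieldTheory.Balaban1983to89.B9Thm39OneCubeReadingAtLettersY (oneCubeOps39YF)
open Literature.MathematicalPhysics.QuantumFieldTheory.Balaban1983to89.B9Thm39ReadingAtLetters (basis39 κ39)
open Literature.MathematicalPhysics.QuantumFieldTheory.Balaban1983to89.B9Thm39ReadingCoords (cR39)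
open Literature.MathematicalPhysics.QuantumFieldTheory.Balaban1983to89.B9CoReadingCoords (blkBK)
open Literature.MathematicalPhysics.QuantumFieldTheory.Balaban1983to89.B9CoReadingCoordsS (XSK blkSK sIK GcoS DcoS)
open Literature.MathematicalPhysics.QuantumFieldTheory.Balaban1983to89.B9Ineq349SiteReading (fineEntryS)
open Literature.MathematicalPhysics.QuantumFieldTheory.Balaban1983to89.B9Ineq349SiteComposite (lenB distB lenB_pos Left342At Right342At Blk348At)
open Literature.MathematicalPhysics.QuantumFieldTheory.Balaban1983to89.B9Ineq349SiteFromBlocks (geo9Y_M_eq)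
open Literature.MathematicalPhysics.QuantumFieldTheory.Balaban1983to89.B9Ineq349SiteFromConv342 (left342At_of_hasMajorants contractive_of_mem)
open Literature.MathematicalPhysics.QuantumFieldTheory.Balaban1983to89.B9Ineq349SiteFromConv348 (blk348At_of_hasMajorant)
open Literature.MathematicalPhysics.QuantumFieldTheory.Balaban1983to89.B9Ineq349SiteAdjoint (right342At_of_left342At isSymmTr_GpY_parSymY)
open Literature.MathematicalPhysics.QuantumFieldTheory.Balaban1983to89.B9Thm311ReadingCoords (IsSymmTr)
open Literature.MathematicalPhysics.QuantumFieldTheory.Balaban1983to89.B9RWSumsDefinitePins (PinPrims)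
open Literature.MathematicalPhysics.QuantumFieldTheory.Balaban1983to89.B9RWSumsDefinitePinsPair (PairPrims)
open Literature.MathematicalPhysics.QuantumFieldTheory.Balaban1983to89.B9RWSumsDefinitePinsPairM (MixedPrims E37YPairM)
open Literature.MathematicalPhysics.QuantumFieldTheory.Balaban1983to89.B9RWSums347DefiniteFaces (exp261)
open Literature.MathematicalPhysics.QuantumFieldTheory.Balaban1983to89.B7Prop2SpecialUnitary (specialUnitaryUnits specialUnitaryUnits_le_unitaryUnits)
open Literature.MathematicalPhysics.QuantumFieldTheory.Balaban1983to89.B9PinMembersKLevelV1 (MemberY geo9Y bg9Y)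
open Literature.MathematicalPhysics.QuantumFieldTheory.Balaban1983to89.B9RWSumsReadsNbr (nbr)
open Literature.MathematicalPhysics.QuantumFieldTheory.Balaban1983to89.B9PerturbationMajorantAlgebra (Proj349Maj)
open Literature.MathematicalPhysics.QuantumFieldTheory.Balaban1983to89.B9PerturbationMajorantsAtLetters (PcoK)
open Literature.MathematicalPhysics.QuantumFieldTheory.Balaban1983to89.Node00.OpsYSectDCoords (DvcoKH DvscoKH)
open Literature.MathematicalPhysics.QuantumFieldTheory.Balaban1983to89.B9Proj349MajFromBlocks (proj349Maj_of_allBlocks)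
open Literature.MathematicalPhysics.QuantumFieldTheory.Balaban1983to89.B9SitePinBlockCounts (exists_card_nearBlocks_le)
open scoped Matrix.Norms.L2Operator

variable {N : ℕ} {κ : Type} [Fintype κ] [DecidableEq κ]

/-! ## §1 Row 25's two inputs with their rates exposed -/

/-- ★ **THE (3.42) INPUTS OF (3.49) AT THE RATE OF THE PINS**: for a letters family `𝔏` with def-Y's standard `parS ∕ Gp`, row 18's Theorem-3.7 leaf `t37` on the
`PairM` E-letter (first conjunct of its convergence predicate: `Conv342 (𝔬 x) 1 (H x) (p.C (exp261 geo9Y p.δ₀ p.α)) ((1−2p.α)p.δ₀) U`) at the site pins gives, above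
ONE threshold and in ONE regime, `Left342At` AND `Right342At` for `(𝔏 x).Gp` over `(𝔏 x).parS` with the SAME constant and the EXPOSED rate `(1−2p.α)p.δ₀`
(left: n06-i's `left342At_of_hasMajorants`; right: `right342At_of_left342At` through the symmetry `isSymmTr_GpY_parSymY` and `G ≤ U(N)`; constants `B, N·B ≤ max 1 N · B`).
[cite: Balaban1985BackgroundPropagators, Thm 3.1 (3.42) p.397 ⇐ Thm 3.7 pp.409–410; (3.25) p.394, (3.35) p.396; (3.49) p.399] -/
theorem left_right342_of_t37_pairM_of (θ : Stage3Params) (Mstar : ℕ) (𝔏 : LettersY N θ Mstar)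
    (hparS : ∀ x : MemberY θ.d₆ θ.ℓ₆ θ.hd' θ.hL' θ.b₀ θ.b₁ Mstar, (𝔏 x).parS = parSymY x.toKIdx)
    (hGp : ∀ x : MemberY θ.d₆ θ.ℓ₆ θ.hd' θ.hL' θ.b₀ θ.b₁ Mstar, (𝔏 x).Gp = GpY x.toKIdx (parSymY x.toKIdx))
    [∀ x : MemberY θ.d₆ θ.ℓ₆ θ.hd' θ.hL' θ.b₀ θ.b₁ Mstar, Fintype (geo9Y x).Site] [∀ x : MemberY θ.d₆ θ.ℓ₆ θ.hd' θ.hL' θ.b₀ θ.b₁ Mstar, DecidableEq (geo9Y x).Site]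
    (b : Module.Basis κ ℝ (Matrix (Fin N) (Fin N) ℂ)) {c35 : ℝ}
    {bI : ∀ x : MemberY θ.d₆ θ.ℓ₆ θ.hd' θ.hL' θ.b₀ θ.b₁ Mstar, FBondY x.toKIdx → IBondY x.toKIdx}
    (hlev : ∀ (x : MemberY θ.d₆ θ.ℓ₆ θ.hd' θ.hL' θ.b₀ θ.b₁ Mstar) (f : FBondY x.toKIdx), lvl x.hN x.D x.hk (bI x f) = (blkV1 x.hN x.D f).1.1)
    (hβ1 : ∀ (x : MemberY θ.d₆ θ.ℓ₆ θ.hd' θ.hL' θ.b₀ θ.b₁ Mstar) (f : FBondY x.toKIdx),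
      (B6Geom246MultiLevelTorus.geomT x.D).dist (β x.hN x.D x.hk (bI x f)) (blkV1 x.hN x.D f) ≤ 1)
    {mN : ℕ} (hnbr : ∀ (x : MemberY θ.d₆ θ.ℓ₆ θ.hd' θ.hL' θ.b₀ θ.b₁ Mstar) (y : (geo9Y x).Site), (nbr (geo9Y x) 2 y).card ≤ mN)
    {ι : MemberY θ.d₆ θ.ℓ₆ θ.hd' θ.hL' θ.b₀ θ.b₁ Mstar → Type}
    (𝔬 : ∀ x : MemberY θ.d₆ θ.ℓ₆ θ.hd' θ.hL' θ.b₀ θ.b₁ Mstar, Ops (geo9Y x) (bg9Y (Matrix (Fin N) (Fin N) ℂ) (specialUnitaryUnits (Fin N)) x)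
      (XSK κ x.toKIdx) (XSK κ x.toKIdx) (ι x))
    (rd : ∀ x : MemberY θ.d₆ θ.ℓ₆ θ.hd' θ.hL' θ.b₀ θ.b₁ Mstar, WalkReading (geo9Y x) (bg9Y (Matrix (Fin N) (Fin N) ℂ) (specialUnitaryUnits (Fin N)) x)
      (XSK κ x.toKIdx) (ι x))
    (H : MemberY θ.d₆ θ.ℓ₆ θ.hd' θ.hL' θ.b₀ θ.b₁ Mstar → Prop) {m mN' : ℕ} {Cev NQ : ℝ} {p q : PinPrims} (hp : p.OK) {p3 q3 : PairPrims}
    {pM qM : MixedPrims}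
    {K : ∀ x : MemberY θ.d₆ θ.ℓ₆ θ.hd' θ.hL' θ.b₀ θ.b₁ Mstar, B9.KernelFamily (geo9Y x) (bg9Y (Matrix (Fin N) (Fin N) ℂ) (specialUnitaryUnits (Fin N)) x)}
    (t37 : B9.Thm37Printed c35 (fun x : MemberY θ.d₆ θ.ℓ₆ θ.hd' θ.hL' θ.b₀ θ.b₁ Mstar => geo9Y x)
      (fun x => bg9Y (Matrix (Fin N) (Fin N) ℂ) (specialUnitaryUnits (Fin N)) x)
      (fun x => E37YPairM (bg := bg9Y (Matrix (Fin N) (Fin N) ℂ) (specialUnitaryUnits (Fin N))) m mN' Cev NQ p q p3 q3 pM qM (𝔬 x) (rd x) (H x) (K x)))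
    (hblkS : ∀ x : MemberY θ.d₆ θ.ℓ₆ θ.hd' θ.hL' θ.b₀ θ.b₁ Mstar, (𝔬 x).blk = blkSK x.toKIdx (sIK x.toKIdx (bI x)))
    (hblkYS : ∀ x : MemberY θ.d₆ θ.ℓ₆ θ.hd' θ.hL' θ.b₀ θ.b₁ Mstar, (𝔬 x).blkY = blkSK x.toKIdx (sIK x.toKIdx (bI x)))
    (hGpS : ∀ (x : MemberY θ.d₆ θ.ℓ₆ θ.hd' θ.hL' θ.b₀ θ.b₁ Mstar) (U : (bg9Y (Matrix (Fin N) (Fin N) ℂ) (specialUnitaryUnits (Fin N)) x).Cfg),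
      (𝔬 x).Gp U = GcoS x.toKIdx b (bg9Y (Matrix (Fin N) (Fin N) ℂ) (specialUnitaryUnits (Fin N)) x) (fun U => U) (𝔏 x).Gp U)
    (hDS : ∀ (x : MemberY θ.d₆ θ.ℓ₆ θ.hd' θ.hL' θ.b₀ θ.b₁ Mstar) (U : (bg9Y (Matrix (Fin N) (Fin N) ℂ) (specialUnitaryUnits (Fin N)) x).Cfg),
      (𝔬 x).D U = DcoS x.toKIdx b (bg9Y (Matrix (Fin N) (Fin N) ℂ) (specialUnitaryUnits (Fin N)) x) (fun U => U) U) :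
    ∃ M₁ a₀ B₀ : ℝ, 0 < M₁ ∧ 0 < a₀ ∧ 0 ≤ B₀ ∧
      ∀ x : MemberY θ.d₆ θ.ℓ₆ θ.hd' θ.hL' θ.b₀ θ.b₁ Mstar, M₁ ≤ (geo9Y x).M → ∀ α₀ : ℝ, 0 < α₀ → (geo9Y x).M * α₀ ≤ a₀ →
        ∀ U : (bg9Y (Matrix (Fin N) (Fin N) ℂ) (specialUnitaryUnits (Fin N)) x).Cfg,
          (bg9Y (Matrix (Fin N) (Fin N) ℂ) (specialUnitaryUnits (Fin N)) x).Reg335 c35 α₀ U →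
          Left342At x.toKIdx (𝔏 x).parS (𝔏 x).Gp U B₀ ((1 - 2 * p.α) * p.δ₀) ∧
            Right342At x.toKIdx (𝔏 x).parS (𝔏 x).Gp U B₀ ((1 - 2 * p.α) * p.δ₀) := by
  obtain ⟨M₂, a₀, hM₂, ha₀, H37⟩ := t37
  set C : ℝ := p.C (exp261 (@geo9Y θ.d₆ θ.ℓ₆ θ.hd' θ.hL' θ.b₀ θ.b₁ Mstar) p.δ₀ p.α) with hCdef
  set δ : ℝ := (1 - 2 * p.α) * p.δ₀ with hδdef
  have hC : 0 ≤ C := p.C_nonneg hp _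
  have hδ : 0 < δ := PinPrims.rate_pos hp
  have hB0 : 0 ≤ (mN : ℝ) * C * Real.exp (2 * δ) := by positivity
  refine ⟨M₂, a₀, max 1 (N : ℝ) * ((mN : ℝ) * C * Real.exp (2 * δ)), hM₂, ha₀, by positivity, fun x hM α₀ hα₀ hMa U hU => ?_⟩
  -- row 18's leaf: the first conjunct of the `PairM` E-letter's convergence predicate at the site pins
  obtain ⟨h0, h1, -, -⟩ := (show Conv342 (𝔬 x) 1 (H x) C δ U from (H37 x hM α₀ hα₀ hMa U hU).1)
  rw [hblkS x, hGpS x U] at h0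
  rw [hblkS x, hblkYS x, hGpS x U, hDS x U] at h1
  have hUG : ∀ μ y, U μ y ∈ specialUnitaryUnits (Fin N) := hU.1.1
  have hUu : ∀ μ y, (U μ y : Matrix (Fin N) (Fin N) ℂ) ∈ unitary (Matrix (Fin N) (Fin N) ℂ) :=
    fun μ y => specialUnitaryUnits_le_unitaryUnits (hUG μ y)
  have hpar : ∀ z w : SiteY x.toKIdx, ‖((𝔏 x).parS U z w : Matrix (Fin N) (Fin N) ℂ)‖ ≤ 1 ∧
      ‖((((𝔏 x).parS U z w)⁻¹ : (Matrix (Fin N) (Fin N) ℂ)ˣ) : Matrix (Fin N) (Fin N) ℂ)‖ ≤ 1 := fun z w =>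
    contractive_of_mem specialUnitaryUnits_le_unitaryUnits (by rw [hparS x]; exact parSymY_mem x.toKIdx hUG z w)
  have hparu : ∀ (s : BlkY x.toKIdx) (z : SiteY x.toKIdx),
      ((𝔏 x).parS U (blkCornerY x.toKIdx s) z : Matrix (Fin N) (Fin N) ℂ) ∈ unitary (Matrix (Fin N) (Fin N) ℂ) := fun s z =>
    specialUnitaryUnits_le_unitaryUnits (by rw [hparS x]; exact parSymY_mem x.toKIdx hUG _ z)
  have hsymm : IsSymmTr (fun _ => (1 : ℝ)) ((𝔏 x).Gp U) := by
    rw [hGp x]; exact isSymmTr_GpY_parSymY x.toKIdx specialUnitaryUnits_le_unitaryUnits hUG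
  have hLe := left342At_of_hasMajorants (κ := κ) x b (B := bg9Y (Matrix (Fin N) (Fin N) ℂ) (specialUnitaryUnits (Fin N)) x) (fun U => U)
    (𝔏 x).Gp (𝔏 x).parS U (hlev x) (hβ1 x) (hnbr x) hpar hC hδ.le h0 h1
  have hRi := right342At_of_left342At x.toKIdx hUu hparu hsymm hB0 hLe
  -- both schemas are monotone in the constant: `B, N·B ≤ max 1 N · B`
  have hle₁ : (mN : ℝ) * C * Real.exp (2 * δ) ≤ max 1 (N : ℝ) * ((mN : ℝ) * C * Real.exp (2 * δ)) := by nlinarith [le_max_left (1 : ℝ) N]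
  have hle₂ : (N : ℝ) * ((mN : ℝ) * C * Real.exp (2 * δ)) ≤ max 1 (N : ℝ) * ((mN : ℝ) * C * Real.exp (2 * δ)) :=
    mul_le_mul_of_nonneg_right (le_max_right _ _) hB0
  refine ⟨fun s s₁ F hF z hz => ⟨?_, fun μ => ?_⟩, fun s₂ s' x' hx' E hE => ⟨?_, fun ν => ?_⟩⟩
  · exact (hLe s s₁ F hF z hz).1.trans (by
      have := (lenB_pos x.toKIdx s).le
      exact mul_le_mul_of_nonneg_right (mul_le_mul_of_nonneg_right hle₁ (pow_nonneg this 2)) (Real.exp_nonneg _))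
  · exact ((hLe s s₁ F hF z hz).2 μ).trans (by
      have := (lenB_pos x.toKIdx s).le
      exact mul_le_mul_of_nonneg_right (mul_le_mul_of_nonneg_right hle₁ this) (Real.exp_nonneg _))
  · exact (hRi s₂ s' x' hx' E hE).1.trans (by
      have := (lenB_pos x.toKIdx s').le
      exact mul_le_mul_of_nonneg_right (mul_le_mul_of_nonneg_right hle₂ (pow_nonneg this 2)) (Real.exp_nonneg _))
  · exact ((hRi s₂ s' x' hx' E hE).2 ν).trans (by
      have := (lenB_pos x.toKIdx s').le
      exact mul_le_mul_of_nonneg_right (mul_le_mul_of_nonneg_right hle₂ this) (Real.exp_nonneg _))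

/-- ★ **THE (3.48) INPUT OF (3.49) AT THE DISPLAYED RATE**: rows 15–16's one display `h348` — `Conv348Blk` of the one-cube letters on the faithful block map,
i.e. (`rfl`) a two-sided inverse of `L39 (𝔏 x).parS (𝔏 x).Gp U` with the [4]-(2.51) majorant `B₁(Lʲη)⁻⁴e^{−δ₁d}` w.r.t. `blk39F (bI x)` — gives `Blk348At` at EVERY
member of its regime with the constant `cR39 (basis39 _)·|κ39|·B₁·e^{2δ₁}` and the EXPOSED rate `δ₁` (n06-i's `blk348At_of_hasMajorant`; the prefix
`c35·M·α₀ ≤ a₁` read as `M·α₀ ≤ a₁∕c35`). [cite: Balaban1985BackgroundPropagators, Thm 3.2 (3.48) p.398 ⇐ Thm 3.9 pp.411–413, (3.96) p.411; Balaban1984PropagatorsII, (2.51) p.232] -/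
theorem blk348_of_display348_rate (θ : Stage3Params) (Mstar : ℕ) (𝔏 : LettersY N θ Mstar)
    [∀ x : MemberY θ.d₆ θ.ℓ₆ θ.hd' θ.hL' θ.b₀ θ.b₁ Mstar, Fintype (geo9Y x).Site]
    (bI : ∀ x : MemberY θ.d₆ θ.ℓ₆ θ.hd' θ.hL' θ.b₀ θ.b₁ Mstar, FBondY x.toKIdx → IBondY x.toKIdx)
    (hlev : ∀ (x : MemberY θ.d₆ θ.ℓ₆ θ.hd' θ.hL' θ.b₀ θ.b₁ Mstar) (f : FBondY x.toKIdx), lvl x.hN x.D x.hk (bI x f) = (blkV1 x.hN x.D f).1.1)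
    (hβ1 : ∀ (x : MemberY θ.d₆ θ.ℓ₆ θ.hd' θ.hL' θ.b₀ θ.b₁ Mstar) (f : FBondY x.toKIdx),
      (B6Geom246MultiLevelTorus.geomT x.D).dist (β x.hN x.D x.hk (bI x f)) (blkV1 x.hN x.D f) ≤ 1)
    {c35 : ℝ} (hc : 0 < c35) {B₁ δ₁ a₁ M₁ : ℝ} (hB : 0 ≤ B₁) (hδ : 0 < δ₁)
    (h348 : ∀ x : MemberY θ.d₆ θ.ℓ₆ θ.hd' θ.hL' θ.b₀ θ.b₁ Mstar, M₁ ≤ (geo9Y x).M → ∀ α₀ : ℝ, 0 < α₀ → c35 * (geo9Y x).M * α₀ ≤ a₁ →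
      ∀ U : (bg9Y (Matrix (Fin N) (Fin N) ℂ) (specialUnitaryUnits (Fin N)) x).Cfg,
        (bg9Y (Matrix (Fin N) (Fin N) ℂ) (specialUnitaryUnits (Fin N)) x).Reg335 c35 α₀ U → Conv348Blk (oneCubeOps39YF θ Mstar 𝔏 bI x) B₁ δ₁ U)
    (x : MemberY θ.d₆ θ.ℓ₆ θ.hd' θ.hL' θ.b₀ θ.b₁ Mstar) (hM : M₁ ≤ (geo9Y x).M) (α₀ : ℝ) (hα₀ : 0 < α₀) (hMa : (geo9Y x).M * α₀ ≤ a₁ / c35)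
    (U : (bg9Y (Matrix (Fin N) (Fin N) ℂ) (specialUnitaryUnits (Fin N)) x).Cfg)
    (hU : (bg9Y (Matrix (Fin N) (Fin N) ℂ) (specialUnitaryUnits (Fin N)) x).Reg335 c35 α₀ U) :
    Blk348At x.toKIdx (𝔏 x).parS (𝔏 x).Gp U
      (cR39 (basis39 (Matrix (Fin N) (Fin N) ℂ)) * Fintype.card (κ39 (Matrix (Fin N) (Fin N) ℂ)) * B₁ * Real.exp (2 * δ₁)) δ₁ := by
  have hMa' : c35 * (geo9Y x).M * α₀ ≤ a₁ := by
    rw [mul_assoc]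
    calc c35 * ((geo9Y x).M * α₀) ≤ c35 * (a₁ / c35) := mul_le_mul_of_nonneg_left hMa hc.le
      _ = a₁ := mul_div_cancel₀ a₁ hc.ne'
  obtain ⟨T, hTL, hLT, hm⟩ := h348 x hM α₀ hα₀ hMa' U hU
  exact blk348At_of_hasMajorant x (𝔏 x).parS (𝔏 x).Gp U (hlev x) (hβ1 x) hB hδ.le T hTL hLT hm

/-! ## §2 ★★ The (3.49) majorant schema of the certificate at an explicit rate -/

/-- ★★ **`Proj349Maj` — THE CERTIFICATE's `h49` — AT def-Y's MEMBERS WITH ITS RATE `θ` EXPOSED**.  Inputs: a letters family `𝔏` with the standard `parS ∕ Gp`;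
row 18's leaf `t37` on the `PairM` E-letter at the site pins (§1); rows 15–16's display `h348` (§1); the direction-blind, level-∕1-faithful block map `bI`
(`hbI0 hlev hβ1`) and the radius-2 count `hnbr`; and a (3.49) THRESHOLD FACT `hthr` AT THE RATE `θ` for the rate pair `((1−2p.α)p.δ₀, δ₁)` — the inner statement of
n06-i's `exists_threshold_349` ([4] Lemma 2.1 on the block torus: the three fine entries of `P(U) = I − R(U)` at every block pair bounded by
`B₀·B₁·B₀·Cg·[1,ℓ⁻¹,ℓ⁻¹,ℓ⁻²]_n(s)·(L^{j′}η)^{−d′}·e^{−θ d(s,s′)}` from `Left342At ∕ Right342At … B₀ δ₀` and `Blk348At … B₁ δ₁`) with `θ` a PARAMETER.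
Output: ONE threshold `M`, ONE regime `a`, ONE constant `CP ≥ 0`, and for every member ∕ `α₀` ∕ `U` under (3.35) the block-majorant schema
`Proj349Maj (blkSK (sIK (bI x))) (blkBK (bI x)) (PcoK … (𝔏 x).parS (𝔏 x).Gp U) (DvcoKH … U) (DvscoKH … U) 1 (H x) CP θ` (dag-n06-l's `proj349Maj_of_allBlocks` with
the near-block count `exists_card_nearBlocks_le`).  At def-Y's records `parS = parSymY`, `Gp = GpY … (parSymY …)` by `rfl`: the certificate's `h49` up to
the pins `hblkW12 ∕ hblk12`. [cite: Balaban1985BackgroundPropagators, (3.49) p.399 («using again Lemma 2.1»), p.421 («using Theorem 3.1 and the inequality (3.49)»), Thm 3.1 (3.42) p.397, Thm 3.2 (3.48) p.398; Balaban1984PropagatorsII, Lemma 2.1 (2.59)–(2.61) pp.233–234, (2.51)–(2.52) p.232] -/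
theorem proj349Maj_of_t37_display348_rate (θ : Stage3Params) (Mstar : ℕ) (𝔏 : LettersY N θ Mstar)
    (hparS : ∀ x : MemberY θ.d₆ θ.ℓ₆ θ.hd' θ.hL' θ.b₀ θ.b₁ Mstar, (𝔏 x).parS = parSymY x.toKIdx)
    (hGp : ∀ x : MemberY θ.d₆ θ.ℓ₆ θ.hd' θ.hL' θ.b₀ θ.b₁ Mstar, (𝔏 x).Gp = GpY x.toKIdx (parSymY x.toKIdx))
    [∀ x : MemberY θ.d₆ θ.ℓ₆ θ.hd' θ.hL' θ.b₀ θ.b₁ Mstar, Fintype (geo9Y x).Site] [∀ x : MemberY θ.d₆ θ.ℓ₆ θ.hd' θ.hL' θ.b₀ θ.b₁ Mstar, DecidableEq (geo9Y x).Site]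
    (b : Module.Basis κ ℝ (Matrix (Fin N) (Fin N) ℂ)) (hcb : 0 < cR39 b) {c35 : ℝ} (hc : 0 < c35)
    {bI : ∀ x : MemberY θ.d₆ θ.ℓ₆ θ.hd' θ.hL' θ.b₀ θ.b₁ Mstar, FBondY x.toKIdx → IBondY x.toKIdx}
    (hbI0 : ∀ (x : MemberY θ.d₆ θ.ℓ₆ θ.hd' θ.hL' θ.b₀ θ.b₁ Mstar) (f : FBondY x.toKIdx), bI x f = bI x ⟨f.src, 0⟩)
    (hlev : ∀ (x : MemberY θ.d₆ θ.ℓ₆ θ.hd' θ.hL' θ.b₀ θ.b₁ Mstar) (f : FBondY x.toKIdx), lvl x.hN x.D x.hk (bI x f) = (blkV1 x.hN x.D f).1.1)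
    (hβ1 : ∀ (x : MemberY θ.d₆ θ.ℓ₆ θ.hd' θ.hL' θ.b₀ θ.b₁ Mstar) (f : FBondY x.toKIdx),
      (B6Geom246MultiLevelTorus.geomT x.D).dist (β x.hN x.D x.hk (bI x f)) (blkV1 x.hN x.D f) ≤ 1)
    {mN : ℕ} (hnbr : ∀ (x : MemberY θ.d₆ θ.ℓ₆ θ.hd' θ.hL' θ.b₀ θ.b₁ Mstar) (y : (geo9Y x).Site), (nbr (geo9Y x) 2 y).card ≤ mN)
    -- row 18: Theorem 3.7's leaf on the `PairM` E-letter at the site pins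
    {ι : MemberY θ.d₆ θ.ℓ₆ θ.hd' θ.hL' θ.b₀ θ.b₁ Mstar → Type}
    (𝔬 : ∀ x : MemberY θ.d₆ θ.ℓ₆ θ.hd' θ.hL' θ.b₀ θ.b₁ Mstar, Ops (geo9Y x) (bg9Y (Matrix (Fin N) (Fin N) ℂ) (specialUnitaryUnits (Fin N)) x)
      (XSK κ x.toKIdx) (XSK κ x.toKIdx) (ι x))
    (rd : ∀ x : MemberY θ.d₆ θ.ℓ₆ θ.hd' θ.hL' θ.b₀ θ.b₁ Mstar, WalkReading (geo9Y x) (bg9Y (Matrix (Fin N) (Fin N) ℂ) (specialUnitaryUnits (Fin N)) x)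
      (XSK κ x.toKIdx) (ι x))
    (H : MemberY θ.d₆ θ.ℓ₆ θ.hd' θ.hL' θ.b₀ θ.b₁ Mstar → Prop) {m mN' : ℕ} {Cev NQ : ℝ} {p q : PinPrims} (hp : p.OK) {p3 q3 : PairPrims}
    {pM qM : MixedPrims}
    {K : ∀ x : MemberY θ.d₆ θ.ℓ₆ θ.hd' θ.hL' θ.b₀ θ.b₁ Mstar, B9.KernelFamily (geo9Y x) (bg9Y (Matrix (Fin N) (Fin N) ℂ) (specialUnitaryUnits (Fin N)) x)}
    (t37 : B9.Thm37Printed c35 (fun x : MemberY θ.d₆ θ.ℓ₆ θ.hd' θ.hL' θ.b₀ θ.b₁ Mstar => geo9Y x)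
      (fun x => bg9Y (Matrix (Fin N) (Fin N) ℂ) (specialUnitaryUnits (Fin N)) x)
      (fun x => E37YPairM (bg := bg9Y (Matrix (Fin N) (Fin N) ℂ) (specialUnitaryUnits (Fin N))) m mN' Cev NQ p q p3 q3 pM qM (𝔬 x) (rd x) (H x) (K x)))
    (hblkS : ∀ x : MemberY θ.d₆ θ.ℓ₆ θ.hd' θ.hL' θ.b₀ θ.b₁ Mstar, (𝔬 x).blk = blkSK x.toKIdx (sIK x.toKIdx (bI x)))
    (hblkYS : ∀ x : MemberY θ.d₆ θ.ℓ₆ θ.hd' θ.hL' θ.b₀ θ.b₁ Mstar, (𝔬 x).blkY = blkSK x.toKIdx (sIK x.toKIdx (bI x)))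
    (hGpS : ∀ (x : MemberY θ.d₆ θ.ℓ₆ θ.hd' θ.hL' θ.b₀ θ.b₁ Mstar) (U : (bg9Y (Matrix (Fin N) (Fin N) ℂ) (specialUnitaryUnits (Fin N)) x).Cfg),
      (𝔬 x).Gp U = GcoS x.toKIdx b (bg9Y (Matrix (Fin N) (Fin N) ℂ) (specialUnitaryUnits (Fin N)) x) (fun U => U) (𝔏 x).Gp U)
    (hDS : ∀ (x : MemberY θ.d₆ θ.ℓ₆ θ.hd' θ.hL' θ.b₀ θ.b₁ Mstar) (U : (bg9Y (Matrix (Fin N) (Fin N) ℂ) (specialUnitaryUnits (Fin N)) x).Cfg),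
      (𝔬 x).D U = DcoS x.toKIdx b (bg9Y (Matrix (Fin N) (Fin N) ℂ) (specialUnitaryUnits (Fin N)) x) (fun U => U) U)
    -- rows 15–16: the one display `(3.48)⁻¹` on the faithful one-cube letters over `𝔏`
    {B₁ δ₁ a₁ M₁ : ℝ} (hB : 0 ≤ B₁) (hδ : 0 < δ₁) (ha₁ : 0 < a₁)
    (h348 : ∀ x : MemberY θ.d₆ θ.ℓ₆ θ.hd' θ.hL' θ.b₀ θ.b₁ Mstar, M₁ ≤ (geo9Y x).M → ∀ α₀ : ℝ, 0 < α₀ → c35 * (geo9Y x).M * α₀ ≤ a₁ →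
      ∀ U : (bg9Y (Matrix (Fin N) (Fin N) ℂ) (specialUnitaryUnits (Fin N)) x).Cfg,
        (bg9Y (Matrix (Fin N) (Fin N) ℂ) (specialUnitaryUnits (Fin N)) x).Reg335 c35 α₀ U → Conv348Blk (oneCubeOps39YF θ Mstar 𝔏 bI x) B₁ δ₁ U)
    -- the (3.49) threshold fact AT THE RATE θ for the rate pair ((1−2α)δ₀, δ₁)
    (θ₉ Cg M₃ : ℝ) (hθ₉ : 0 ≤ θ₉) (hCg : 0 ≤ Cg)
    (hthr : ∀ i : KIdx θ.d₆ θ.ℓ₆ θ.hd' θ.hL' θ.b₀ θ.b₁, M₃ ≤ ((θ.ℓ₆ : ℝ) + 1) * i.Mh →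
      ∀ (parS : SiteParY (Matrix (Fin N) (Fin N) ℂ) i) (Gp : SiteOpY (Matrix (Fin N) (Fin N) ℂ) i) (U : CfgY (Matrix (Fin N) (Fin N) ℂ) i) (B₀ B₁' : ℝ),
        0 ≤ B₀ → 0 ≤ B₁' → Left342At i parS Gp U B₀ ((1 - 2 * p.α) * p.δ₀) → Right342At i parS Gp U B₀ ((1 - 2 * p.α) * p.δ₀) →
        Blk348At i parS Gp U B₁' δ₁ →
          ∀ (n : Fin 4) (s s' : BlkY i), fineEntryS i (P349Y i parS Gp) U s s' n ≤
            B₀ * B₁' * B₀ * Cg * B9.pref4inv (lenB i s) n * lenB i s' ^ (-((θ.d₆ + 1 : ℕ) : ℝ)) * Real.exp (-(θ₉ * distB i s s'))) :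
    ∃ M a CP : ℝ, 0 < M ∧ 0 < a ∧ 0 ≤ CP ∧
      ∀ x : MemberY θ.d₆ θ.ℓ₆ θ.hd' θ.hL' θ.b₀ θ.b₁ Mstar, M ≤ (geo9Y x).M → ∀ α₀ : ℝ, 0 < α₀ → (geo9Y x).M * α₀ ≤ a →
        ∀ U : (bg9Y (Matrix (Fin N) (Fin N) ℂ) (specialUnitaryUnits (Fin N)) x).Cfg,
          (bg9Y (Matrix (Fin N) (Fin N) ℂ) (specialUnitaryUnits (Fin N)) x).Reg335 c35 α₀ U →
          Proj349Maj (g := geo9Y x) (blkSK x.toKIdx (sIK x.toKIdx (bI x))) (blkBK x.toKIdx (bI x))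
            (PcoK x.toKIdx b (bg9Y (Matrix (Fin N) (Fin N) ℂ) (specialUnitaryUnits (Fin N)) x) (fun U => U) (𝔏 x).parS (𝔏 x).Gp U)
            (DvcoKH x.toKIdx b (bg9Y (Matrix (Fin N) (Fin N) ℂ) (specialUnitaryUnits (Fin N)) x) (fun U => U) U)
            (DvscoKH x.toKIdx b (bg9Y (Matrix (Fin N) (Fin N) ℂ) (specialUnitaryUnits (Fin N)) x) (fun U => U) U) 1 (H x) CP θ₉ := by
  obtain ⟨M₂, a₀, B₀, hM₂, ha₀, hB₀, h342⟩ :=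
    left_right342_of_t37_pairM_of θ Mstar 𝔏 hparS hGp b hlev hβ1 hnbr 𝔬 rd H hp t37 hblkS hblkYS hGpS hDS
  obtain ⟨ML, N₁, hN₁0, hN⟩ := exists_card_nearBlocks_le (d := θ.d₆) (ℓ := θ.ℓ₆) (hd := θ.hd') (hL := θ.hL') (b₀ := θ.b₀) (b₁ := θ.b₁) (Mstar := Mstar)
  set B₁' : ℝ := cR39 (basis39 (Matrix (Fin N) (Fin N) ℂ)) * Fintype.card (κ39 (Matrix (Fin N) (Fin N) ℂ)) * B₁ * Real.exp (2 * δ₁) with hB₁'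
  have hB₁'0 : 0 ≤ B₁' := by
    rw [hB₁']; exact mul_nonneg (mul_nonneg (mul_nonneg (B9Thm39ReadingCoords.cR39_nonneg _) (Nat.cast_nonneg _)) hB) (Real.exp_nonneg _)
  set C : ℝ := B₀ * B₁' * B₀ * Cg with hC
  have hC0 : 0 ≤ C := by rw [hC]; positivity
  have hcb' : 0 ≤ B9Thm39ReadingCoords.coordBound39 b := norm_nonneg _
  have hbb' : 0 ≤ B9Thm39ReadingCoords.basisBound39 b := Finset.sum_nonneg fun _ _ => norm_nonneg _
  refine ⟨max (max M₂ M₁) (max M₃ ML), min a₀ (a₁ / c35),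
    ((θ.d₆ + 1 : ℕ) : ℝ) * (B9Thm39ReadingCoords.coordBound39 b * B9Thm39ReadingCoords.basisBound39 b * N₁ * C * Real.exp (2 * θ₉)),
    lt_of_lt_of_le hM₂ ((le_max_left _ _).trans (le_max_left _ _)), lt_min ha₀ (div_pos ha₁ hc), by positivity,
    fun x hM α₀ hα₀ hMa U hU => ?_⟩
  have hM2 : M₂ ≤ (geo9Y x).M := ((le_max_left _ _).trans (le_max_left _ _)).trans hM
  have hM1 : M₁ ≤ (geo9Y x).M := ((le_max_right _ _).trans (le_max_left _ _)).trans hM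
  have hM3 : M₃ ≤ (geo9Y x).M := ((le_max_left _ _).trans (le_max_right _ _)).trans hM
  have hML : ML ≤ (geo9Y x).M := ((le_max_right _ _).trans (le_max_right _ _)).trans hM
  obtain ⟨hL, hR⟩ := h342 x hM2 α₀ hα₀ (hMa.trans (min_le_left _ _)) U hU
  have hBk := blk348_of_display348_rate θ Mstar 𝔏 bI hlev hβ1 hc hB hδ h348 x hM1 α₀ hα₀ (hMa.trans (min_le_right _ _)) U hU
  have hM3' : M₃ ≤ ((θ.ℓ₆ : ℝ) + 1) * x.Mh := (geo9Y_M_eq x) ▸ hM3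
  have hP := hthr x.toKIdx hM3' (𝔏 x).parS (𝔏 x).Gp U B₀ B₁' hB₀ hB₁'0 hL hR hBk
  exact proj349Maj_of_allBlocks x b hcb (𝔏 x).parS (𝔏 x).Gp U (hbI0 x) (hlev x) (hβ1 x) hN₁0 (hN x hML) hC0 hθ₉ hP 1 (H x)

end Summit.QuantumFields.YangMills.BalabanUVNodes.N06Proj349AtPinsPhys

end
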